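import Literature.NumberTheory.Automorphic.TorusRootSubgroupsGenerate
import Literature.NumberTheory.Automorphic.CentralizerLieAlgebra
import Literature.NumberTheory.Automorphic.CentralizerTorusConnected
import HarnessLib

/-!
# The centre of a connected reductive group (Springer 7.6.4 (iii), 8.1.8 (i)): what is proved
(trunk T-AUTOMORPHIC, G25 AutomorphicL; proof file of the named fact
`mem_center_iff_forall_roots` of `IsomorphismTheoremUnique.lean`)

`IsomorphismTheoremUnique.lean` vendors Springer, *Linear Algebraic Groups*, 2nd ed.,
Prop. 8.1.8 (i), p. 147 — *"The center `C(G)` of `G` is the intersection of the kernels `Ker α`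
(`α ∈ R`)"*, `G` connected reductive over an algebraically closed field, `T` a maximal torus,
`R = R(G, T)` — as the named fact `mem_center_iff_forall_roots` (a closed `Prop` over
`G, T ≤ GL n k`, every characteristic), and proves the printed proof (*"`C(G)` lies in `T` by
7.6.4 (iii). Then (i) follows from 8.1.1"*) as the reduction
`mem_center_iff_forall_roots_of : centralizer_eq_of_isMaximalTorusIn (7.6.4 (ii)) →
torus_sup_rootSubgroups_eq (8.1.1 (ii)) → mem_center_iff_forall_roots`. Since then 7.6.4 (ii)
has become a theorem of the tree in every characteristic (`centralizer_eq_of_isMaximalTorusIn_holds`,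
`CentralizerTorusConnected.lean`: 6.4.7 (i), 6.4.8 (ii) and Luna's form of Chevalley's theorem
7.6.3), and so has 5.4.7 (`IsTorusSubgroup.lieWeightSpace_one_le_lieAlgebraGL_centralizer`,
`CentralizerLieAlgebra.lean`). This file records what that buys for 8.1.8 (i), over an
algebraically closed field `k`:

* **7.6.4 (iii) proved in every characteristic** — `mem_torus_of_mem_center`: `C(G) ⊆ T`
  (`center_le_torus` fed with `centralizer_eq_of_isMaximalTorusIn_holds`), and with it the
  inclusion **`C(G) ⊆ ⋂_{α ∈ R} Ker α`** of 8.1.8 (i) (`forall_roots_apply_eq_one_of_mem_center`;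
  the elementary `root_apply_eq_one_of_mem_center`);
* **8.1.8 (i) in every characteristic from 8.1.1 (ii) alone**
  (`mem_center_iff_forall_roots.of_torus_sup_rootSubgroups_eq`) **and from 8.1.2 alone**
  (`mem_center_iff_forall_roots.of_lieWeights_eq_roots`): the generation statement 8.1.1 (ii)
  follows in every characteristic from the named fact `lieWeights_eq_roots` (8.1.2: `P = R`,
  `dim 𝔤_α = 1`) by the Lie-algebra argument of 7.1.3 (i)
  (`torus_sup_rootSubgroups_eq_of_facts`, `TorusRootSubgroupsGenerate.lean`), its second input
  `𝔤^T ⊆ L(T)` being now a theorem (5.4.7 with 7.6.4 (ii), as above) —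
  `torus_sup_rootSubgroups_eq.of_lieWeights_eq_roots`;
* **8.1.8 (i) proved outright in characteristic `0`** — `mem_center_iff_forall_roots.of_charZero`
  (`mem_center_iff_forall_roots_of_charZero` of `TorusRootSubgroupsGenerate.lean`, whose only
  hypothesis was 7.6.4 (ii)).

What remains for the discharge `mem_center_iff_forall_roots_holds` (every characteristic, as the
fact is stated) is therefore exactly the named fact `lieWeights_eq_roots` (Springer 8.1.2) in
positive characteristic, i.e. the existence half of 8.1.1 (i) there: producing root homomorphisms
`u_α : 𝔾ₐ → G` from the structure of the rank-one groups `G_α = Z_G((Ker α)°)` (7.2.3, 7.3.3 (i),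
with 3.4.9: a connected unipotent group of dimension one is `𝔾ₐ`), for which the exponential of
characteristic `0` is not available. No named fact is introduced here and no statement of the tree
is changed.

## References

* [SpringerLAG1998] T. A. Springer, *Linear Algebraic Groups*, 2nd ed., Progress in Mathematics 9,
  Birkhäuser (1998): Prop. 8.1.8 (i) and its proof (p. 147), Cor. 7.6.4 (ii)–(iii) (p. 134),
  Prop. 8.1.1 (ii), Cor. 8.1.2, Lemma 7.1.3 (i), Cor. 5.4.7.
-/

noncomputable section

open scoped MatrixGroups IsMulCommutative

namespace Literature.NumberTheory.Automorphic

variable {k : Type*} [Field k] {n : Type*} [Fintype n] [DecidableEq n]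
variable {G T : Subgroup (GL n k)}

/-! ### Springer 7.6.4 (iii) and the inclusion `C(G) ⊆ ⋂ Ker α`, every characteristic -/

/-- **Springer 7.6.4 (iii), proved: the centre of a connected reductive group lies in every
maximal torus.** For `G ≤ GL n k` connected reductive over an algebraically closed field (any
characteristic) and `T` a maximal torus, `C(G) ⊆ T`: *"observe that `C(G) ⊂ Z_G(T)`"* and
`Z_G(T) = T` (7.6.4 (ii), `centralizer_eq_of_isMaximalTorusIn_holds`); this is `center_le_torus`
of `IsomorphismTheoremUnique.lean` with its hypothesis discharged.
[cite: SpringerLAG1998, Cor. 7.6.4 (iii)] -/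
theorem mem_torus_of_mem_center [IsAlgClosed k] (hG : IsConnectedReductive G)
    (hT : IsMaximalTorusIn T G) {g : ↥G} (hg : g ∈ Subgroup.center ↥G) : (g : GL n k) ∈ T :=
  center_le_torus centralizer_eq_of_isMaximalTorusIn_holds hG hT hg

/-- **Springer 8.1.8 (i), the inclusion `C(G) ⊆ ⋂_{α ∈ R} Ker α`, proved in every
characteristic**: a central element of a connected reductive `G` (over an algebraically closed
field) lies in the maximal torus `T` (7.6.4 (iii), `mem_torus_of_mem_center`) and is killed by
every root of `(G, T)` (`root_apply_eq_one_of_mem_center`: `u(α(g) x) = g u(x) g⁻¹ = u(x)` and root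
homomorphisms are injective). [cite: SpringerLAG1998, Prop. 8.1.8 (i)] -/
theorem forall_roots_apply_eq_one_of_mem_center [IsAlgClosed k] (hG : IsConnectedReductive G)
    (hT : IsMaximalTorusIn T G) {g : ↥G} (hg : g ∈ Subgroup.center ↥G) :
    ∃ hgT : (g : GL n k) ∈ T, ∀ α ∈ roots G T, (α : ↥T →* kˣ) ⟨(g : GL n k), hgT⟩ = 1 :=
  ⟨mem_torus_of_mem_center hG hT hg, fun _ hα => root_apply_eq_one_of_mem_center hg _ hα⟩

/-! ### Every characteristic: 8.1.8 (i) from 8.1.1 (ii), and from 8.1.2 -/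

/-- **Springer 8.1.1 (ii) (`torus_sup_rootSubgroups_eq`) in every characteristic from 8.1.2
(`lieWeights_eq_roots`) alone.** `torus_sup_rootSubgroups_eq_of_facts`
(`TorusRootSubgroupsGenerate.lean`, the Lie-algebra argument of 7.1.3 (i)) takes 8.1.2 and the
named fact `lieWeightSpace_one_le_lieAlgebraGL` (`𝔤^T ⊆ L(T)`); the latter is now a theorem in
every characteristic — Springer 5.4.7 for `D = T`
(`IsTorusSubgroup.lieWeightSpace_one_le_lieAlgebraGL_centralizer`, `CentralizerLieAlgebra.lean`)
with 7.6.4 (ii) (`centralizer_eq_of_isMaximalTorusIn_holds`), assembled by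
`lieWeightSpace_one_le_lieAlgebraGL_of_centralizer` (`RootSpaceDimension.lean`).
[cite: SpringerLAG1998, Prop. 8.1.1 (ii) with Cor. 8.1.2, Lemma 7.1.3 (i), Cor. 5.4.7, Cor. 7.6.4 (ii)] -/
theorem torus_sup_rootSubgroups_eq.of_lieWeights_eq_roots
    (h : lieWeights_eq_roots (G := G) (T := T)) :
    torus_sup_rootSubgroups_eq (G := G) (T := T) :=
  torus_sup_rootSubgroups_eq_of_facts h
    (lieWeightSpace_one_le_lieAlgebraGL_of_centralizer
      (fun hG hT => hT.2.1.lieWeightSpace_one_le_lieAlgebraGL_centralizer hG.1 hT.1)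
      centralizer_eq_of_isMaximalTorusIn_holds)

/-- **Springer 8.1.8 (i) in every characteristic from 8.1.1 (ii) alone**: the printed proof
(`mem_center_iff_forall_roots_of`) with its first input 7.6.4 (ii) discharged
(`centralizer_eq_of_isMaximalTorusIn_holds`); the named fact `torus_sup_rootSubgroups_eq`
(8.1.1 (ii): `T` and the `U_α` generate `G`) is the remaining hypothesis.
[cite: SpringerLAG1998, Prop. 8.1.8 (i) (proof)] -/
theorem mem_center_iff_forall_roots.of_torus_sup_rootSubgroups_eq
    (h : torus_sup_rootSubgroups_eq (G := G) (T := T)) :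
    mem_center_iff_forall_roots (G := G) (T := T) :=
  mem_center_iff_forall_roots_of centralizer_eq_of_isMaximalTorusIn_holds h

/-- **Springer 8.1.8 (i) in every characteristic from 8.1.2 alone** (`lieWeights_eq_roots`:
`P = R` and `dim 𝔤_α = 1`), through `torus_sup_rootSubgroups_eq.of_lieWeights_eq_roots`. This is
the exact remaining frontier of the discharge of `mem_center_iff_forall_roots`: 8.1.2 in positive
characteristic. [cite: SpringerLAG1998, Prop. 8.1.8 (i) with Prop. 8.1.1 (ii) and Cor. 8.1.2] -/
theorem mem_center_iff_forall_roots.of_lieWeights_eq_roots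
    (h : lieWeights_eq_roots (G := G) (T := T)) :
    mem_center_iff_forall_roots (G := G) (T := T) :=
  mem_center_iff_forall_roots.of_torus_sup_rootSubgroups_eq
    (torus_sup_rootSubgroups_eq.of_lieWeights_eq_roots h)

/-! ### Characteristic `0`: 8.1.8 (i) outright -/

/-- **Springer 8.1.8 (i) proved over algebraically closed fields of characteristic `0`**: for
`G ≤ GL n k` connected reductive, `T` a maximal torus and `g ∈ G`, *`g` is central iff `g ∈ T` and
`α(g) = 1` for every root `α` of `(G, T)`* — the named fact `mem_center_iff_forall_roots` for
`(G, T)`, with no hypothesis left (`mem_center_iff_forall_roots_of_charZero` of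
`TorusRootSubgroupsGenerate.lean`, i.e. 8.1.1 (ii) by the exponential, fed with 7.6.4 (ii),
`centralizer_eq_of_isMaximalTorusIn_holds`). In particular it holds for every complex dual group.
[cite: SpringerLAG1998, Prop. 8.1.8 (i)] -/
theorem mem_center_iff_forall_roots.of_charZero [CharZero k] :
    mem_center_iff_forall_roots (G := G) (T := T) :=
  mem_center_iff_forall_roots_of_charZero centralizer_eq_of_isMaximalTorusIn_holds

end Literature.NumberTheory.Automorphic

end
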